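import Mathlib.Analysis.Complex.Basic

/-!
# `BalabanUV.T4Continuum.Support.FiniteVarianceGluing` — NE2 (node U1a) formalisation swarm, sub-row `T4-U1a.S-NE2-D1-DIRICHLET°`,
# supplier item «Δ1-HOLEFILL» (brick H-B, part 1 of 3): GENERIC VARIANCE ALGEBRA ON FINITE SETS — Steiner's identity, the mass of a
# function vanishing on a sub-set, and the GLUING of two overlapping Poincaré domains (unit b2b-balaban-t4-ne2-formalise-leaf-08, gen 6, file 1)

HONEST FRAMING.  Rung (B)+1 bookkeeping at MODEL level; [folklore] finite sums; NE2 (U1a) is NOT proved by this file; spine PROVED 0/9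
unchanged; NOT infinite volume, NOT the mass gap, NOT Clay.  HONEST DEPENDENCY (verbatim): «continuum YM on T⁴ ⇐ BetaPertH ∧ nine spine
estimates (0/9 proved); BetaPertH ⇐ (D1) ∧ (D4) ∧ CAP+tail; G-an2-4 gates asym, D1 and NE2/3/4.»

WHY.  Widman's hole-filling step at a boundary vertex of a union of unit blocks (memo `t4/T4-EST-NE2-D1-LOCAL.md` §5, bricks H-B/H-C)
needs a Poincaré inequality WITH ZERO SET on a cube ANNULUS, which is not a product set.  The annulus is covered by `2d` coordinate slabs
(products); the present file is the set algebra that turns «Poincaré on each slab» + «the field vanishes on an octant» into «mass on the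
annulus ≤ C·(sum of the slab Dirichlet forms)»: for `f : ι → ℂ` and finite sets,
 * §1 `cmean s f = (Σ_s f)/|s|`, `cvar s f = Σ_s ‖f − cmean s f‖²`, STEINER **`sum_norm_sub_sq_eq`**: `Σ_s ‖f i − c‖² = cvar s f + |s|·‖cmean s f − c‖²`,
   hence `cvar_le_sum_norm_sub_sq` (the mean minimises), `cvar_mono` (`t ⊆ s ⇒ cvar t f ≤ cvar s f`) and
   `card_mul_norm_cmean_sub_sq_le` (`W ⊆ U ⇒ |W|·‖cmean W f − c‖² ≤ Σ_U ‖f − c‖²`);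
 * §2 **`sum_norm_sq_le_of_vanish`**: `f = 0` on a non-empty `T ⊆ s` ⇒ `Σ_s ‖f‖² ≤ (1 + |s|/|T|)·cvar s f`;
 * §3 **`gluing`**: `W ⊆ U ∩ V` non-empty ⇒ `Σ_{U ∪ V} ‖f − cmean U f‖² ≤ (1 + 2|V|/|W|)·(cvar U f + cvar V f)`, and the mass form
   **`sum_norm_sq_le_of_gluing`**: with `f = 0` on a non-empty `T ⊆ U`, `Σ_V ‖f‖² ≤ 2(1 + 2|V|/|W|)(cvar U f + cvar V f) + 2(|V|/|T|)·cvar U f`;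
 * §4 **`cvar_comp_of_cover`**: a `k`-to-one cover `π` (`Σ_s g∘π = k·Σ_{s'} g` for all `g`) preserves the mean and multiplies the variance by
   `k` — the bookkeeping behind the even-reflection doubling of the next file (`CoordSlabPoincare`).

ABSOLUTE RULE (cell, verbatim): «No internally-minted statement may enter as a cited fact. Every hypothesis is either kernel-proved in
this package or a verbatim quotation of a PUBLISHED theorem with page reference. The manuscript(s) under audit are NOT citable for
their own disputed steps — they are the thing under adjudication; programme-internal (2001/route/tribunal) claims are never citable.»
[folklore]; two `def`s (`cmean`, `cvar`: plain data, no `Prop`); no `def … : Prop` fact.  NOT CLAIMED: any Poincaré inequality (next files);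
anything at the residue; NE2; NE3.
-/

open scoped BigOperators ComplexConjugate
open Finset

namespace Summit.QuantumFields.BalabanUV.T4Continuum.FiniteVarianceGluing

variable {ι : Type*} [DecidableEq ι]

/-! ## §1 Mean, variance, Steiner -/

/-- the complex MEAN of `f` over the finite set `s` (`0` on the empty set, by `x / 0 = 0`). [folklore] -/
noncomputable def cmean (s : Finset ι) (f : ι → ℂ) : ℂ := (∑ i ∈ s, f i) / (s.card : ℂ)

/-- the (unnormalised) VARIANCE `Σ_{i ∈ s} ‖f i − cmean s f‖²`. [folklore] -/
noncomputable def cvar (s : Finset ι) (f : ι → ℂ) : ℝ := ∑ i ∈ s, ‖f i - cmean s f‖ ^ 2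

omit [DecidableEq ι] in
/-- `cvar ≥ 0`. [folklore] -/
theorem cvar_nonneg (s : Finset ι) (f : ι → ℂ) : 0 ≤ cvar s f := Finset.sum_nonneg fun _ _ => sq_nonneg _

omit [DecidableEq ι] in
/-- the deviations from the mean sum to zero (non-empty set). [folklore] -/
theorem sum_sub_cmean (s : Finset ι) (f : ι → ℂ) (hs : s.Nonempty) : ∑ i ∈ s, (f i - cmean s f) = 0 := by
  have hc : (s.card : ℂ) ≠ 0 := by exact_mod_cast hs.card_pos.ne'
  rw [Finset.sum_sub_distrib, Finset.sum_const, nsmul_eq_mul, cmean, mul_div_cancel₀ _ hc, sub_self]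

omit [DecidableEq ι] in
/-- **STEINER'S IDENTITY**: `Σ_s ‖f i − c‖² = cvar s f + |s|·‖cmean s f − c‖²` for every constant `c`. [folklore] -/
theorem sum_norm_sub_sq_eq (s : Finset ι) (f : ι → ℂ) (c : ℂ) :
    ∑ i ∈ s, ‖f i - c‖ ^ 2 = cvar s f + s.card * ‖cmean s f - c‖ ^ 2 := by
  rcases s.eq_empty_or_nonempty with hs | hs
  · subst hs; simp [cvar]
  have hsplit : ∀ i, f i - c = (f i - cmean s f) + (cmean s f - c) := fun i => by ring
  -- `‖u + v‖² = ‖u‖² + ‖v‖² + 2·Re(conj u · v)` (the tree's `…BoseGas.norm_add_sq_complex`, kept local to this import cone)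
  have hnorm : ∀ u v : ℂ, ‖u + v‖ ^ 2 = ‖u‖ ^ 2 + ‖v‖ ^ 2 + 2 * (conj u * v).re := fun u v => by
    have h : (conj u * v).re = (u * conj v).re := by
      rw [← Complex.conj_re (u * conj v), map_mul, Complex.conj_conj]
    rw [h, Complex.sq_norm, Complex.sq_norm, Complex.sq_norm, Complex.normSq_add]
  simp_rw [hsplit, hnorm]
  rw [Finset.sum_add_distrib, Finset.sum_add_distrib, Finset.sum_const, nsmul_eq_mul, cvar]
  have h0 : ∑ i ∈ s, 2 * (conj (f i - cmean s f) * (cmean s f - c)).re = 0 := by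
    rw [← Finset.mul_sum, ← Complex.re_sum, ← Finset.sum_mul, ← map_sum, sum_sub_cmean s f hs, map_zero, zero_mul,
      Complex.zero_re, mul_zero]
  rw [h0, add_zero]

omit [DecidableEq ι] in
/-- the mean minimises the square deviation: `cvar s f ≤ Σ_s ‖f i − c‖²` for every `c`. [folklore] -/
theorem cvar_le_sum_norm_sub_sq (s : Finset ι) (f : ι → ℂ) (c : ℂ) : cvar s f ≤ ∑ i ∈ s, ‖f i - c‖ ^ 2 := by
  rw [sum_norm_sub_sq_eq]
  have : 0 ≤ (s.card : ℝ) * ‖cmean s f - c‖ ^ 2 := by positivity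
  linarith

omit [DecidableEq ι] in
/-- MONOTONICITY of the variance in the set: `t ⊆ s ⇒ cvar t f ≤ cvar s f`. [folklore] -/
theorem cvar_mono {t s : Finset ι} (h : t ⊆ s) (f : ι → ℂ) : cvar t f ≤ cvar s f :=
  (cvar_le_sum_norm_sub_sq t f (cmean s f)).trans (Finset.sum_le_sum_of_subset_of_nonneg h fun _ _ _ => sq_nonneg _)

omit [DecidableEq ι] in
/-- the mean over a SUB-set is close to any constant in terms of the square deviation over the big set:
`W ⊆ U ⇒ |W|·‖cmean W f − c‖² ≤ Σ_U ‖f i − c‖²`. [folklore] -/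
theorem card_mul_norm_cmean_sub_sq_le {W U : Finset ι} (h : W ⊆ U) (f : ι → ℂ) (c : ℂ) :
    (W.card : ℝ) * ‖cmean W f - c‖ ^ 2 ≤ ∑ i ∈ U, ‖f i - c‖ ^ 2 := by
  have h1 := sum_norm_sub_sq_eq W f c
  have h2 : ∑ i ∈ W, ‖f i - c‖ ^ 2 ≤ ∑ i ∈ U, ‖f i - c‖ ^ 2 :=
    Finset.sum_le_sum_of_subset_of_nonneg h fun _ _ _ => sq_nonneg _
  linarith [cvar_nonneg W f]

/-! ## §2 Mass from a vanishing sub-set -/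

omit [DecidableEq ι] in
/-- if `f` vanishes on `T`, the mean over `T` is `0`. [folklore] -/
theorem cmean_eq_zero_of_vanish {T : Finset ι} {f : ι → ℂ} (hz : ∀ i ∈ T, f i = 0) : cmean T f = 0 := by
  rw [cmean, Finset.sum_eq_zero hz, zero_div]

omit [DecidableEq ι] in
/-- **MASS FROM A VANISHING SUB-SET**: if `f = 0` on a non-empty `T ⊆ s`, then `Σ_s ‖f i‖² ≤ (1 + |s|/|T|)·cvar s f`. [folklore] -/
theorem sum_norm_sq_le_of_vanish {T s : Finset ι} (hT : T ⊆ s) (hTn : T.Nonempty) {f : ι → ℂ} (hz : ∀ i ∈ T, f i = 0) :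
    ∑ i ∈ s, ‖f i‖ ^ 2 ≤ (1 + s.card / T.card) * cvar s f := by
  have hTpos : (0 : ℝ) < T.card := by exact_mod_cast hTn.card_pos
  -- Steiner with `c = 0`
  have h1 : ∑ i ∈ s, ‖f i‖ ^ 2 = cvar s f + s.card * ‖cmean s f‖ ^ 2 := by
    have := sum_norm_sub_sq_eq s f 0; simp only [sub_zero] at this; exact this
  -- `|T|·‖cmean s f‖² ≤ cvar s f` (the mean over `T` vanishes)
  have h2 : (T.card : ℝ) * ‖cmean s f‖ ^ 2 ≤ cvar s f := by
    have h := card_mul_norm_cmean_sub_sq_le hT f (cmean s f)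
    rw [cmean_eq_zero_of_vanish hz, zero_sub, norm_neg] at h
    exact h
  have h3 : (s.card : ℝ) * ‖cmean s f‖ ^ 2 ≤ s.card / T.card * cvar s f := by
    rw [div_mul_eq_mul_div, le_div_iff₀ hTpos]
    calc (s.card : ℝ) * ‖cmean s f‖ ^ 2 * T.card = s.card * (T.card * ‖cmean s f‖ ^ 2) := by ring
      _ ≤ s.card * cvar s f := mul_le_mul_of_nonneg_left h2 (Nat.cast_nonneg _)
  rw [h1]; linarith

/-! ## §3 Gluing two overlapping sets -/

/-- sums of a non-negative function over a union are at most the sum of the two sums. [folklore] -/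
theorem sum_union_le_add {g : ι → ℝ} (hg : ∀ i, 0 ≤ g i) (U V : Finset ι) :
    ∑ i ∈ U ∪ V, g i ≤ ∑ i ∈ U, g i + ∑ i ∈ V, g i := by
  rw [← Finset.sum_union_inter]
  have : 0 ≤ ∑ i ∈ U ∩ V, g i := Finset.sum_nonneg fun i _ => hg i
  linarith

/-- **GLUING**: for `W ⊆ U ∩ V` non-empty, `Σ_{U ∪ V} ‖f i − cmean U f‖² ≤ (1 + 2|V|/|W|)·(cvar U f + cvar V f)` — the two means differ by at
most `√(2(cvar U + cvar V)/|W|)` because both are close to the mean over the overlap. [folklore] -/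
theorem gluing {W U V : Finset ι} (hWU : W ⊆ U) (hWV : W ⊆ V) (hWn : W.Nonempty) (f : ι → ℂ) :
    ∑ i ∈ U ∪ V, ‖f i - cmean U f‖ ^ 2 ≤ (1 + 2 * V.card / W.card) * (cvar U f + cvar V f) := by
  have hWpos : (0 : ℝ) < W.card := by exact_mod_cast hWn.card_pos
  have hU : ∑ i ∈ U, ‖f i - cmean U f‖ ^ 2 = cvar U f := rfl
  -- Steiner on `V` about the constant `cmean U f`
  have hV : ∑ i ∈ V, ‖f i - cmean U f‖ ^ 2 = cvar V f + V.card * ‖cmean V f - cmean U f‖ ^ 2 := sum_norm_sub_sq_eq V f _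
  -- the two means are both close to the mean over `W`
  have hWU' : (W.card : ℝ) * ‖cmean W f - cmean U f‖ ^ 2 ≤ cvar U f := card_mul_norm_cmean_sub_sq_le hWU f _
  have hWV' : (W.card : ℝ) * ‖cmean W f - cmean V f‖ ^ 2 ≤ cvar V f := card_mul_norm_cmean_sub_sq_le hWV f _
  have hdiff : ‖cmean V f - cmean U f‖ ^ 2 ≤ 2 * ‖cmean W f - cmean U f‖ ^ 2 + 2 * ‖cmean W f - cmean V f‖ ^ 2 := by
    have htri : ‖cmean V f - cmean U f‖ ≤ ‖cmean W f - cmean U f‖ + ‖cmean W f - cmean V f‖ := by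
      have : cmean V f - cmean U f = (cmean W f - cmean U f) - (cmean W f - cmean V f) := by ring
      rw [this]; exact norm_sub_le _ _
    nlinarith [htri, norm_nonneg (cmean V f - cmean U f), norm_nonneg (cmean W f - cmean U f),
      norm_nonneg (cmean W f - cmean V f), sq_nonneg (‖cmean W f - cmean U f‖ - ‖cmean W f - cmean V f‖)]
  have hmean : (V.card : ℝ) * ‖cmean V f - cmean U f‖ ^ 2 ≤ 2 * V.card / W.card * (cvar U f + cvar V f) := by
    have h1 : (W.card : ℝ) * ‖cmean V f - cmean U f‖ ^ 2 ≤ 2 * (cvar U f + cvar V f) := by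
      calc (W.card : ℝ) * ‖cmean V f - cmean U f‖ ^ 2
          ≤ W.card * (2 * ‖cmean W f - cmean U f‖ ^ 2 + 2 * ‖cmean W f - cmean V f‖ ^ 2) :=
            mul_le_mul_of_nonneg_left hdiff (Nat.cast_nonneg _)
        _ = 2 * (W.card * ‖cmean W f - cmean U f‖ ^ 2) + 2 * (W.card * ‖cmean W f - cmean V f‖ ^ 2) := by ring
        _ ≤ 2 * (cvar U f + cvar V f) := by linarith
    rw [mul_comm (2 : ℝ) (V.card : ℝ), mul_div_assoc, mul_assoc]
    refine mul_le_mul_of_nonneg_left ?_ (Nat.cast_nonneg _)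
    rw [div_mul_eq_mul_div, le_div_iff₀ hWpos]
    linarith
  calc ∑ i ∈ U ∪ V, ‖f i - cmean U f‖ ^ 2
      ≤ ∑ i ∈ U, ‖f i - cmean U f‖ ^ 2 + ∑ i ∈ V, ‖f i - cmean U f‖ ^ 2 := sum_union_le_add (fun _ => sq_nonneg _) U V
    _ = cvar U f + cvar V f + V.card * ‖cmean V f - cmean U f‖ ^ 2 := by rw [hU, hV]; ring
    _ ≤ cvar U f + cvar V f + 2 * V.card / W.card * (cvar U f + cvar V f) := by linarith
    _ = (1 + 2 * V.card / W.card) * (cvar U f + cvar V f) := by ring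

/-- **MASS ON THE GLUED SET**: `W ⊆ U ∩ V` and `T ⊆ U` non-empty, `f = 0` on `T` ⇒
`Σ_V ‖f i‖² ≤ 2(1 + 2|V|/|W|)(cvar U f + cvar V f) + 2(|V|/|T|)·cvar U f`. [folklore] -/
theorem sum_norm_sq_le_of_gluing {W U V T : Finset ι} (hWU : W ⊆ U) (hWV : W ⊆ V) (hWn : W.Nonempty) (hT : T ⊆ U)
    (hTn : T.Nonempty) {f : ι → ℂ} (hz : ∀ i ∈ T, f i = 0) :
    ∑ i ∈ V, ‖f i‖ ^ 2 ≤ 2 * (1 + 2 * V.card / W.card) * (cvar U f + cvar V f) + 2 * (V.card / T.card) * cvar U f := by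
  have hTpos : (0 : ℝ) < T.card := by exact_mod_cast hTn.card_pos
  -- `‖f i‖² ≤ 2‖f i − m_U‖² + 2‖m_U‖²`
  have hpt : ∀ i, ‖f i‖ ^ 2 ≤ 2 * ‖f i - cmean U f‖ ^ 2 + 2 * ‖cmean U f‖ ^ 2 := fun i => by
    have htri : ‖f i‖ ≤ ‖f i - cmean U f‖ + ‖cmean U f‖ := by
      have : f i = (f i - cmean U f) + cmean U f := by ring
      rw [this]; exact (norm_add_le _ _).trans (le_of_eq (by rw [← this]))
    nlinarith [htri, norm_nonneg (f i), norm_nonneg (f i - cmean U f), norm_nonneg (cmean U f),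
      sq_nonneg (‖f i - cmean U f‖ - ‖cmean U f‖)]
  have h1 : ∑ i ∈ V, ‖f i‖ ^ 2 ≤ 2 * ∑ i ∈ V, ‖f i - cmean U f‖ ^ 2 + 2 * (V.card * ‖cmean U f‖ ^ 2) := by
    calc ∑ i ∈ V, ‖f i‖ ^ 2 ≤ ∑ i ∈ V, (2 * ‖f i - cmean U f‖ ^ 2 + 2 * ‖cmean U f‖ ^ 2) := Finset.sum_le_sum fun i _ => hpt i
      _ = _ := by rw [Finset.sum_add_distrib, Finset.sum_const, nsmul_eq_mul, ← Finset.mul_sum]; ring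
  have h2 : ∑ i ∈ V, ‖f i - cmean U f‖ ^ 2 ≤ ∑ i ∈ U ∪ V, ‖f i - cmean U f‖ ^ 2 :=
    Finset.sum_le_sum_of_subset_of_nonneg Finset.subset_union_right fun _ _ _ => sq_nonneg _
  have h3 := gluing hWU hWV hWn f
  -- `|T|·‖m_U‖² ≤ cvar U f`
  have h4 : (T.card : ℝ) * ‖cmean U f‖ ^ 2 ≤ cvar U f := by
    have h := card_mul_norm_cmean_sub_sq_le hT f (cmean U f)
    rw [cmean_eq_zero_of_vanish hz, zero_sub, norm_neg] at h
    exact h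
  have h5 : (V.card : ℝ) * ‖cmean U f‖ ^ 2 ≤ V.card / T.card * cvar U f := by
    rw [div_mul_eq_mul_div, le_div_iff₀ hTpos]
    calc (V.card : ℝ) * ‖cmean U f‖ ^ 2 * T.card = V.card * (T.card * ‖cmean U f‖ ^ 2) := by ring
      _ ≤ V.card * cvar U f := mul_le_mul_of_nonneg_left h4 (Nat.cast_nonneg _)
  linarith

/-! ## §4 Covers: a `k`-to-one map multiplies the variance by `k` -/

omit [DecidableEq ι] in
/-- **VARIANCE UNDER A `k`-TO-ONE COVER**: if `π : ι → κ` pushes the counting measure of `s` to `k` times that of `s'`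
(`Σ_{j ∈ s} g (π j) = k·Σ_{j' ∈ s'} g j'` for every `g`), `k ≠ 0`, then `cmean s (F ∘ π) = cmean s' F` and `cvar s (F ∘ π) = k·cvar s' F`. [folklore] -/
theorem cvar_comp_of_cover {κ : Type*} {s : Finset ι} {s' : Finset κ} {π : ι → κ} {k : ℕ} (hk : k ≠ 0)
    (hπ : ∀ g : κ → ℂ, ∑ j ∈ s, g (π j) = k * ∑ j' ∈ s', g j') (F : κ → ℂ) :
    cmean s (F ∘ π) = cmean s' F ∧ cvar s (F ∘ π) = k * cvar s' F := by
  have hkC : (k : ℂ) ≠ 0 := by exact_mod_cast hk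
  -- cardinalities: `|s| = k|s'|`
  have hcard : (s.card : ℂ) = k * s'.card := by
    have h := hπ (fun _ => 1)
    simpa [Finset.sum_const, nsmul_eq_mul] using h
  have hmean : cmean s (F ∘ π) = cmean s' F := by
    rw [cmean, cmean]
    simp only [Function.comp]
    rw [hπ F, hcard]
    rcases eq_or_ne (s'.card : ℂ) 0 with h0 | h0
    · rw [h0, mul_zero, div_zero, div_zero]
    · rw [mul_div_mul_left _ _ hkC]
  refine ⟨hmean, ?_⟩
  rw [cvar, cvar]
  simp only [Function.comp] at hmean ⊢
  rw [hmean]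
  -- the real-valued sum identity, through `ℂ`
  have h := hπ (fun j' => ((‖F j' - cmean s' F‖ ^ 2 : ℝ) : ℂ))
  exact_mod_cast h

end Summit.QuantumFields.BalabanUV.T4Continuum.FiniteVarianceGluing
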